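import Summits.QuantumFields.YangMills.Theses.ConvexGribovBody
import Summits.QuantumFields.YangMills.Theorems.ConvexGribovBodyCovarianceBoundDefs
import Summits.QuantumFields.YangMills.Theorems.FradkinShenkerFlowPoincareToClusteringHeatBath

/-!
# Crux `BrascampLiebVacuumSC` (stmt-QuantumFields-16404), line `SketchIdeator1` — stub `stub_sliceRestriction`

The pure measure-theory step of the line (card `Ideas/up-slice-restriction.md`, steps (1)+(2), sketch
name `sliceDir_of_heatBath`): on the torus `(2S+1)⁴` at coupling `β`, the uniform heat-bath Poincaré
inequality UP with constant `C ≥ 0` (for bounded measurable `F`, one-link heat-bath laws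
`ν_ℓ^U = hbLaw r.ρ β ℓ U`) and the annealed one-link metric-slope inequality with constant `κ₁ ≥ 0`
(for link-Lipschitz `F`) give `Var_μ f ≤ 2Cκ₁ · dir f` for every time-zero-local link-Lipschitz `f`,
`μ = wilson4 r β S` Wilson's measure.

Ingredients:
* a link-Lipschitz `f` is continuous on the compact second-countable configuration space, hence bounded
  and measurable (`sliceRestr_continuous`, `sliceRestr_measurable_bounded`);
* the heat-bath energy of one link is twice the annealed conditional variance,
  `∫∫ (f U − f(U[ℓ ↦ g]))² dν_ℓ^U dμ = 2 ∫ (E_ℓ(f²) − (E_ℓ f)²) dμ` (`sliceRestr_double`), by the DLR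
  identity `∫ E_ℓ h dμ = ∫ h dμ` (`PoincareClustering.integral_hbOp_wilsonMeasure`) and the pull-out
  `E_ℓ((E_ℓ f) f) = (E_ℓ f)²` (`PoincareClustering.hbOp_mul_left`, `hbOp_update`);
* off the time-zero slice the heat-bath energy of a time-zero-local `f` vanishes identically;
* a finite-sum bookkeeping lemma (`sliceRestr_sum_bound`).

References: F. Martinelli, *Lectures on Glauber dynamics for discrete spin models*, LNM 1717 (1999),
§2.3 (heat-bath dynamics, reversibility); H.-O. Georgii, *Gibbs Measures and Phase Transitions* (2011),
Def. 1.23 (DLR consistency).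
-/

open scoped BigOperators Topology Matrix
open Filter MeasureTheory ProbabilityTheory
open Literature.MathematicalPhysics.QuantumFieldTheory
open Summit.QuantumFields.YangMills.Cruxes.CovarianceBound.SupportWindow
  (froSq coulombF IsCoulMin gluon modeCov supCov wilson4)
open Summit.QuantumFields.YangMills.Theorems.PoincareClustering (hbLaw hbOp)

noncomputable section

namespace Summit.QuantumFields.YangMills.Theorems.BrascampLiebVacuumSC

/-! ### Bookkeeping: a finite-sum bound -/

/-- Finite-sum bookkeeping: if `T i ≤ 2 κ I i` on `P` and `T i = 0` off `P`, then
`C Σ T ≤ 2Cκ Σ_{P} I` for `C ≥ 0`. [folklore] -/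
theorem sliceRestr_sum_bound {ι : Type*} [Fintype ι] {T I : ι → ℝ} {P : ι → Prop}
    [DecidablePred P] {C κ : ℝ} (hC : 0 ≤ C) (hon : ∀ i, P i → T i ≤ 2 * (κ * I i))
    (hoff : ∀ i, ¬P i → T i = 0) :
    C * ∑ i, T i ≤ 2 * C * κ * ∑ i, (if P i then I i else 0) := by
  have hR : 2 * C * κ * ∑ i, (if P i then I i else 0) =
      C * ∑ i, 2 * (κ * (if P i then I i else 0)) := by
    rw [Finset.mul_sum, Finset.mul_sum]
    exact Finset.sum_congr rfl fun i _ => by ring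
  rw [hR]
  refine mul_le_mul_of_nonneg_left (Finset.sum_le_sum fun i _ => ?_) hC
  by_cases hi : P i
  · rw [if_pos hi]
    exact hon i hi
  · rw [if_neg hi, hoff i hi, mul_zero, mul_zero]

/-! ### Link-Lipschitz functions are continuous, bounded, measurable -/

section Lipschitz

variable {G : Type} [Group G] [TopologicalSpace G]

/-- A function of the links which is Lipschitz for the Frobenius link pseudo-metric pulled back by the
continuous representation `r.ρ` is continuous on the configuration space. [folklore] -/
theorem sliceRestr_continuous (r : LatticeRep G) {S : ℕ} {f : GaugeConfig 4 (2 * S + 1) G → ℝ}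
    {K : ℝ} (hK : ∀ U V : GaugeConfig 4 (2 * S + 1) G,
      |f U - f V| ≤ K * ∑ e, Real.sqrt (froSq (r.ρ (U e) - r.ρ (V e)))) :
    Continuous f := by
  have hD : ∀ V : GaugeConfig 4 (2 * S + 1) G, Continuous fun U : GaugeConfig 4 (2 * S + 1) G =>
      ∑ e, Real.sqrt (froSq (r.ρ (U e) - r.ρ (V e))) := fun V => by
    refine continuous_finsetSum _ fun e _ => ?_
    refine (continuous_finsetSum _ fun a _ => continuous_finsetSum _ fun b _ => ?_).sqrt
    have he : Continuous fun U : GaugeConfig 4 (2 * S + 1) G => U e := continuous_apply e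
    exact (((r.continuous.comp' he).fun_sub continuous_const).matrix_elem a b).norm.fun_pow 2
  have hD0 : ∀ V : GaugeConfig 4 (2 * S + 1) G,
      (∑ e, Real.sqrt (froSq (r.ρ (V e) - r.ρ (V e)))) = 0 := fun V => by
    simp [froSq]
  refine continuous_iff_continuousAt.2 fun V => ?_
  rw [ContinuousAt, tendsto_iff_norm_sub_tendsto_zero]
  refine squeeze_zero (fun U => norm_nonneg _)
    (fun U => (Real.norm_eq_abs _).le.trans (hK U V)) ?_
  exact (continuous_const.fun_mul (hD V)).tendsto' V 0 (by simp only [hD0 V, mul_zero])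

variable [CompactSpace G] [MeasurableSpace G] [BorelSpace G]

/-- A link-Lipschitz function of the links is measurable and bounded (continuous on a compact
second-countable space; `G` is second countable by the faithful representation `r`). [folklore] -/
theorem sliceRestr_measurable_bounded (r : LatticeRep G) {S : ℕ}
    {f : GaugeConfig 4 (2 * S + 1) G → ℝ}
    (hf : ∃ K : ℝ, ∀ U V : GaugeConfig 4 (2 * S + 1) G,
      |f U - f V| ≤ K * ∑ e, Real.sqrt (froSq (r.ρ (U e) - r.ρ (V e)))) :
    Measurable f ∧ ∃ M : ℝ, ∀ U, |f U| ≤ M := by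
  obtain ⟨K, hK⟩ := hf
  haveI : SecondCountableTopology G :=
    (r.continuous.isClosedEmbedding r.injective).isEmbedding.secondCountableTopology
  have hcont := sliceRestr_continuous r hK
  obtain ⟨M, hM⟩ := isCompact_univ.exists_bound_of_continuousOn hcont.continuousOn
  refine ⟨hcont.measurable, M, fun U => ?_⟩
  have := hM U (Set.mem_univ U)
  rwa [Real.norm_eq_abs] at this

end Lipschitz

/-! ### One link: the heat-bath energy is twice the annealed conditional variance -/

section Link

variable {G : Type} [Group G] [TopologicalSpace G] [IsTopologicalGroup G] [CompactSpace G]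
  [MeasurableSpace G] [BorelSpace G] [SecondCountableTopology G]
  (r : LatticeRep G) (β : ℝ) (S : ℕ)

/-- `|h|≤ M ⇒ |h²| ≤ M²`. [folklore] -/
theorem sliceRestr_abs_sq_le {X : Type*} {h : X → ℝ} {M : ℝ} (hM : ∀ V, |h V| ≤ M) (V : X) :
    |h V ^ 2| ≤ M ^ 2 := by
  rw [abs_pow]
  exact pow_le_pow_left₀ (abs_nonneg _) (hM V) 2

omit [SecondCountableTopology G] in
/-- A bounded measurable function is integrable for Wilson's probability measure `wilson4`. [folklore] -/
theorem sliceRestr_integrable {φ : GaugeConfig 4 (2 * S + 1) G → ℝ} (hφ : Measurable φ) {B : ℝ}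
    (hB : ∀ U, |φ U| ≤ B) : Integrable φ (wilson4 r β S) :=
  Integrable.of_bound hφ.aestronglyMeasurable B
    (ae_of_all _ fun U => by rw [Real.norm_eq_abs]; exact hB U)

/-- The DLR identity for `wilson4`: `∫ E_ℓ h dμ = ∫ h dμ` for bounded measurable `h`
(`PoincareClustering.integral_hbOp_wilsonMeasure`; Georgii 2011 Def. 1.23). [folklore] -/
theorem sliceRestr_integral_hbOp (ℓ : Edge 4 (2 * S + 1)) {h : GaugeConfig 4 (2 * S + 1) G → ℝ}
    (hh : Measurable h) {M : ℝ} (hM : ∀ V, |h V| ≤ M) :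
    ∫ U, hbOp r.ρ β ℓ h U ∂(wilson4 r β S) = ∫ U, h U ∂(wilson4 r β S) :=
  PoincareClustering.integral_hbOp_wilsonMeasure r.ρ β r.continuous ℓ hh hM

/-- The one-link heat-bath energy, pointwise in the background:
`∫ (f U − f(U[ℓ ↦ g]))² dν_ℓ^U(g) = f(U)² − 2 (E_ℓ f)(U) f(U) + E_ℓ(f²)(U)` (`ν_ℓ^U` is a probability
measure). [folklore] -/
theorem sliceRestr_inner (ℓ : Edge 4 (2 * S + 1)) {f : GaugeConfig 4 (2 * S + 1) G → ℝ}
    (hf : Measurable f) {M : ℝ} (hM : ∀ V, |f V| ≤ M) (U : GaugeConfig 4 (2 * S + 1) G) :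
    ∫ g, (f U - f (Function.update U ℓ g)) ^ 2 ∂(hbLaw r.ρ β ℓ U) =
      f U ^ 2 - 2 * (hbOp r.ρ β ℓ f U * f U) + hbOp r.ρ β ℓ (fun V => f V ^ 2) U := by
  haveI := PoincareClustering.isProbabilityMeasure_hbLaw r.ρ β r.continuous ℓ U
  have h1 : Integrable (fun g => f (Function.update U ℓ g)) (hbLaw r.ρ β ℓ U) :=
    PoincareClustering.integrable_comp_update r.ρ β r.continuous ℓ U hf hM
  have h2 : Integrable (fun g => f (Function.update U ℓ g) ^ 2) (hbLaw r.ρ β ℓ U) :=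
    PoincareClustering.integrable_comp_update r.ρ β r.continuous ℓ U (h := fun V => f V ^ 2)
      (hf.pow_const 2) (sliceRestr_abs_sq_le hM)
  have hexp : ∀ g, (f U - f (Function.update U ℓ g)) ^ 2 =
      f U ^ 2 - 2 * f U * f (Function.update U ℓ g) + f (Function.update U ℓ g) ^ 2 :=
    fun g => by ring
  have h3 : Integrable (fun g => 2 * f U * f (Function.update U ℓ g)) (hbLaw r.ρ β ℓ U) :=
    h1.const_mul _
  have h4 : Integrable (fun g => f U ^ 2 - 2 * f U * f (Function.update U ℓ g)) (hbLaw r.ρ β ℓ U) :=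
    (integrable_const _).sub' h3
  simp_rw [hexp]
  rw [integral_add h4 h2, integral_sub (integrable_const _) h3, integral_const, integral_const_mul,
    probReal_univ, one_smul]
  simp only [hbOp]
  ring

/-- **The heat-bath energy of one link is twice the annealed conditional variance**:
`∫∫ (f U − f(U[ℓ ↦ g]))² dν_ℓ^U(g) dμ(U) = 2 ∫ (E_ℓ(f²) − (E_ℓ f)²) dμ` for bounded measurable `f`
(DLR: `∫ E_ℓ(f²) dμ = ∫ f² dμ` and `∫ (E_ℓ f) f dμ = ∫ E_ℓ((E_ℓ f) f) dμ = ∫ (E_ℓ f)² dμ`;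
Martinelli 1999 §2.3, reversibility of the heat bath). [folklore] -/
theorem sliceRestr_double (ℓ : Edge 4 (2 * S + 1)) {f : GaugeConfig 4 (2 * S + 1) G → ℝ}
    (hf : Measurable f) {M : ℝ} (hM : ∀ V, |f V| ≤ M) :
    ∫ U, ∫ g, (f U - f (Function.update U ℓ g)) ^ 2 ∂(hbLaw r.ρ β ℓ U) ∂(wilson4 r β S) =
      2 * ∫ U, (hbOp r.ρ β ℓ (fun V => f V ^ 2) U - (hbOp r.ρ β ℓ f U) ^ 2) ∂(wilson4 r β S) := by
  set μ := wilson4 r β S with hμ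
  set k := hbOp r.ρ β ℓ f with hk
  set k2 := hbOp r.ρ β ℓ (fun V => f V ^ 2) with hk2
  have hM0 : ∀ V : GaugeConfig 4 (2 * S + 1) G, 0 ≤ M := fun V => (abs_nonneg _).trans (hM V)
  -- measurability and bounds
  have hkm : Measurable k := PoincareClustering.measurable_hbOp r.ρ β r.continuous ℓ hf
  have hkb : ∀ U, |k U| ≤ M := PoincareClustering.abs_hbOp_le r.ρ β r.continuous ℓ hM
  have hf2m : Measurable fun V => f V ^ 2 := hf.pow_const 2
  have hf2b : ∀ V, |f V ^ 2| ≤ M ^ 2 := sliceRestr_abs_sq_le hM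
  have hk2m : Measurable k2 := PoincareClustering.measurable_hbOp r.ρ β r.continuous ℓ hf2m
  have hk2b : ∀ U, |k2 U| ≤ M ^ 2 := PoincareClustering.abs_hbOp_le r.ρ β r.continuous ℓ hf2b
  have hkfm : Measurable fun V => k V * f V := hkm.mul hf
  have hkfb : ∀ V, |k V * f V| ≤ M * M := fun V => by
    rw [abs_mul]
    exact mul_le_mul (hkb V) (hM V) (abs_nonneg _) (hM0 V)
  have hkkm : Measurable fun V => k V ^ 2 := hkm.pow_const 2
  have hkkb : ∀ V, |k V ^ 2| ≤ M ^ 2 := sliceRestr_abs_sq_le hkb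
  -- integrability on `μ`
  have if2 : Integrable (fun V => f V ^ 2) μ := sliceRestr_integrable r β S hf2m hf2b
  have ik2 : Integrable k2 μ := sliceRestr_integrable r β S hk2m hk2b
  have ikf : Integrable (fun V => k V * f V) μ := sliceRestr_integrable r β S hkfm hkfb
  have ikk : Integrable (fun V => k V ^ 2) μ := sliceRestr_integrable r β S hkkm hkkb
  -- Step 1: the inner integral
  have step1 : ∫ U, ∫ g, (f U - f (Function.update U ℓ g)) ^ 2 ∂(hbLaw r.ρ β ℓ U) ∂μ =
      ∫ U, (f U ^ 2 - 2 * (k U * f U) + k2 U) ∂μ :=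
    integral_congr_ae (ae_of_all _ fun U => sliceRestr_inner r β S ℓ hf hM U)
  have i2kf : Integrable (fun U => 2 * (k U * f U)) μ := ikf.const_mul _
  have i3 : Integrable (fun U => f U ^ 2 - 2 * (k U * f U)) μ := if2.sub' i2kf
  have step2 : ∫ U, (f U ^ 2 - 2 * (k U * f U) + k2 U) ∂μ =
      ∫ U, f U ^ 2 ∂μ - 2 * ∫ U, k U * f U ∂μ + ∫ U, k2 U ∂μ := by
    rw [integral_add i3 ik2, integral_sub if2 i2kf, integral_const_mul]
  have step3 : ∫ U, (k2 U - k U ^ 2) ∂μ = ∫ U, k2 U ∂μ - ∫ U, k U ^ 2 ∂μ := integral_sub ik2 ikk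
  -- DLR twice
  have dlr1 : ∫ U, k2 U ∂μ = ∫ U, f U ^ 2 ∂μ := sliceRestr_integral_hbOp r β S ℓ hf2m hf2b
  have hmul : ∀ U, hbOp r.ρ β ℓ (fun V => k V * f V) U = k U ^ 2 := fun U => by
    rw [PoincareClustering.hbOp_mul_left r.ρ β ℓ
      (fun U g => PoincareClustering.hbOp_update r.ρ β ℓ f U g) U, sq]
  have dlr2 : ∫ U, k U * f U ∂μ = ∫ U, k U ^ 2 ∂μ := by
    rw [← sliceRestr_integral_hbOp r β S ℓ hkfm hkfb]
    exact integral_congr_ae (ae_of_all _ hmul)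
  rw [step1, step2, step3, dlr2, ← dlr1]
  ring

end Link

/-! ### The stub -/

/-- **Stub (MEASURE THEORY — `sliceDir_of_heatBath`).** On the torus `(2S+1)⁴` at coupling `β`: the heat-bath
Poincaré inequality with constant `C ≥ 0` for bounded measurable functions and the annealed one-link
metric-slope inequality with constant `κ₁ ≥ 0` for link-Lipschitz functions imply
`Var_μ f ≤ 2Cκ₁ · dir f` for every gauge-invariant, time-zero-local, link-Lipschitz `f`
(DLR: `∫∫ (f(U) − f(U[ℓ↦g]))² dν_ℓ^U dμ = 2 ∫ (E_ℓ(f²) − (E_ℓ f)²) dμ`; off the slice both sides of the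
link term vanish). [folklore] -/
theorem stub_sliceRestriction :
    ∀ (G : Type) [Group G] [TopologicalSpace G] [IsTopologicalGroup G] [CompactSpace G]
    [MeasurableSpace G] [BorelSpace G] (r : LatticeRep G) (β C κ₁ : ℝ) (S : ℕ), 0 ≤ C → 0 ≤ κ₁ →
    (∀ F : GaugeConfig 4 (2 * S + 1) G → ℝ, Measurable F → (∃ M : ℝ, ∀ U, |F U| ≤ M) →
      variance F (wilson4 r β S) ≤
        C * ∑ ℓ : Edge 4 (2 * S + 1), ∫ U, ∫ g, (F U - F (Function.update U ℓ g)) ^ 2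
          ∂(hbLaw r.ρ β ℓ U) ∂(wilson4 r β S)) →
    (∀ (ℓ : Edge 4 (2 * S + 1)) (F : GaugeConfig 4 (2 * S + 1) G → ℝ),
      (∃ K : ℝ, ∀ U V : GaugeConfig 4 (2 * S + 1) G,
        |F U - F V| ≤ K * ∑ e, Real.sqrt (froSq (r.ρ (U e) - r.ρ (V e)))) →
      ∫ U, (hbOp r.ρ β ℓ (fun V => F V ^ 2) U - (hbOp r.ρ β ℓ F U) ^ 2) ∂(wilson4 r β S) ≤
        κ₁ * ∫ U, (Filter.limsup (fun g : G => |F (Function.update U ℓ g) - F U| /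
          Real.sqrt (froSq (r.ρ g - r.ρ (U ℓ)))) (𝓝[≠] (U ℓ))) ^ 2 ∂(wilson4 r β S)) →
    ∀ f : GaugeConfig 4 (2 * S + 1) G → ℝ, IsGaugeInvariant f →
      (∀ U V : GaugeConfig 4 (2 * S + 1) G,
        (∀ e : Edge 4 (2 * S + 1), e.1 0 = 0 → e.2 ≠ 0 → U e = V e) → f U = f V) →
      (∃ K : ℝ, ∀ U V : GaugeConfig 4 (2 * S + 1) G,
        |f U - f V| ≤ K * ∑ e, Real.sqrt (froSq (r.ρ (U e) - r.ρ (V e)))) →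
      ∫ U, (f U - ∫ V, f V ∂(wilson4 r β S)) ^ 2 ∂(wilson4 r β S) ≤
        2 * C * κ₁ * ∑ e : Edge 4 (2 * S + 1), (if e.1 0 = 0 ∧ e.2 ≠ 0 then
          ∫ U, (Filter.limsup (fun g : G => |f (Function.update U e g) - f U| /
            Real.sqrt (froSq (r.ρ g - r.ρ (U e)))) (𝓝[≠] (U e))) ^ 2 ∂(wilson4 r β S) else 0) := by
  intro G _ _ _ _ _ _ r β C κ₁ S hC _hκ hUP hHS f _hgi hloc hLip
  haveI : SecondCountableTopology G :=
    (r.continuous.isClosedEmbedding r.injective).isEmbedding.secondCountableTopology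
  obtain ⟨hfm, M, hM⟩ := sliceRestr_measurable_bounded r hLip
  -- `∫ (f − ∫ f)² dμ = Var_μ f`
  rw [← variance_eq_integral hfm.aemeasurable]
  refine (hUP f hfm ⟨M, hM⟩).trans (sliceRestr_sum_bound hC (fun ℓ _ => ?_) (fun ℓ hℓ => ?_))
  · -- a slice link: heat-bath energy = 2 × annealed conditional variance ≤ 2 κ₁ ∫ slope²
    rw [sliceRestr_double r β S ℓ hfm hM]
    exact mul_le_mul_of_nonneg_left (hHS ℓ f hLip) zero_le_two
  · -- off the slice: `f(U[ℓ ↦ g]) = f(U)` by time-zero locality, the energy vanishes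
    have h0 : ∀ (U : GaugeConfig 4 (2 * S + 1) G) (g : G), f (Function.update U ℓ g) = f U :=
      fun U g => hloc _ _ fun e he1 he2 => by
        rw [Function.update_of_ne]
        rintro rfl
        exact hℓ ⟨he1, he2⟩
    simp only [h0, sub_self, ne_eq, OfNat.ofNat_ne_zero, not_false_eq_true, zero_pow,
      integral_zero]

end Summit.QuantumFields.YangMills.Theorems.BrascampLiebVacuumSC

end
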